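import Mathlib

/-!
# Powers of the ideal of a coordinate subspace are integrally closed (transverse order)

Support file for `Theorems/ValuativeGCTValuativeFlipIntegralCut.lean` (crux `ValuativeGCT.ValuativeFlip`,
stmt-ValiantsHypothesis-12624; wall-breaker axis "det-orbit-closure multiplicity bounds for the det
census").  For a set `T` of variables of a polynomial ring over a domain:

* the powers `(X_v : v ∈ T)^e` are the ORDER ideals of the transverse weight (`1` on `T`, `0` off
  `T`): `icut_le_weight_of_mem_pow_span`, `icut_mem_pow_span_of_le_weight`;
* lowest transverse weighted forms multiply (`icut_component_mul`, `icut_component_pow`);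
* hence the valuative criterion `icut_mem_pow_span_of_monic`: `h ^ N + Σ_{i<N} c_i h ^ i = 0` with
  `c_i ∈ (X_T)^((N-i) e)` forces `h ∈ (X_T)^e` — the powers of the ideal of a coordinate subspace
  are integrally closed.

Elementary commutative algebra; no definitions. [folklore]
-/

set_option linter.dupNamespace false

namespace Summit.ValiantsHypothesis.ValiantsHypothesis.Theorems.ValuativeFlip

open MvPolynomial
open scoped BigOperators

noncomputable section

/-! ## §1 Transverse order along a set of variables: weights, powers of `(X_v : v ∈ T)` -/

section Order

variable {τ : Type*} {K : Type*} [CommRing K]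

/-- Weights of the support of a product: if every monomial of `a` has `w`-weight `≥ p` and every
monomial of `b` has `w`-weight `≥ q`, every monomial of `a * b` has `w`-weight `≥ p + q`
(`support (a * b) ⊆ support a + support b`). [folklore] -/
theorem icut_le_weight_support_mul (w : τ → ℕ) {a b : MvPolynomial τ K} {p q : ℕ}
    (ha : ∀ d ∈ a.support, p ≤ Finsupp.weight w d) (hb : ∀ d ∈ b.support, q ≤ Finsupp.weight w d) :
    ∀ d ∈ (a * b).support, p + q ≤ Finsupp.weight w d := by
  classical
  intro d hd
  obtain ⟨x, hx, y, hy, rfl⟩ := Finset.mem_add.mp (support_mul a b hd)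
  rw [map_add]
  exact Nat.add_le_add (ha x hx) (hb y hy)

/-- The part of `a` above its lowest admissible weight: if every monomial of `a` has weight `≥ p`,
every monomial of `a - a_p` has weight `≥ p + 1`. [folklore] -/
theorem icut_le_weight_support_sub_component (w : τ → ℕ) {a : MvPolynomial τ K} {p : ℕ}
    (ha : ∀ d ∈ a.support, p ≤ Finsupp.weight w d) :
    ∀ d ∈ (a - weightedHomogeneousComponent w p a).support, p + 1 ≤ Finsupp.weight w d := by
  classical
  intro d hd
  rw [mem_support_iff, coeff_sub, coeff_weightedHomogeneousComponent] at hd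
  by_cases h : Finsupp.weight w d = p
  · rw [if_pos h, sub_self] at hd
    exact absurd rfl hd
  · rw [if_neg h, sub_zero] at hd
    have h1 := ha d (mem_support_iff.mpr hd)
    omega

/-- Every monomial of the weight-`p` component has weight `p`. [folklore] -/
theorem icut_weight_support_component (w : τ → ℕ) (a : MvPolynomial τ K) (p : ℕ) :
    ∀ d ∈ (weightedHomogeneousComponent w p a).support, Finsupp.weight w d = p := by
  classical
  intro d hd
  rw [mem_support_iff, coeff_weightedHomogeneousComponent] at hd
  by_contra h
  exact hd (if_neg h)

/-- **Lowest weighted forms multiply.** If every monomial of `a` has weight `≥ p` and every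
monomial of `b` has weight `≥ q`, the weight-`(p+q)` component of `a * b` is the product of the
weight-`p` component of `a` and the weight-`q` component of `b`. [folklore] -/
theorem icut_component_mul (w : τ → ℕ) {a b : MvPolynomial τ K} {p q : ℕ}
    (ha : ∀ d ∈ a.support, p ≤ Finsupp.weight w d) (hb : ∀ d ∈ b.support, q ≤ Finsupp.weight w d) :
    weightedHomogeneousComponent w (p + q) (a * b) =
      weightedHomogeneousComponent w p a * weightedHomogeneousComponent w q b := by
  classical
  set a₀ := weightedHomogeneousComponent w p a with ha₀
  set b₀ := weightedHomogeneousComponent w q b with hb₀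
  have hsplit : a * b = a₀ * b₀ + (a₀ * (b - b₀) + (a - a₀) * b) := by ring
  have h1 : weightedHomogeneousComponent w (p + q) (a₀ * b₀) = a₀ * b₀ :=
    ((weightedHomogeneousComponent_isWeightedHomogeneous p a).mul
      (weightedHomogeneousComponent_isWeightedHomogeneous q b)).weightedHomogeneousComponent_same
  have ha₀' : ∀ d ∈ a₀.support, p ≤ Finsupp.weight w d :=
    fun d hd => (icut_weight_support_component w a p d hd).ge
  have h2 : weightedHomogeneousComponent w (p + q) (a₀ * (b - b₀)) = 0 := by
    refine weightedHomogeneousComponent_eq_zero' _ _ fun d hd => ?_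
    have h := icut_le_weight_support_mul w ha₀' (icut_le_weight_support_sub_component w hb) d hd
    omega
  have h3 : weightedHomogeneousComponent w (p + q) ((a - a₀) * b) = 0 := by
    refine weightedHomogeneousComponent_eq_zero' _ _ fun d hd => ?_
    have h := icut_le_weight_support_mul w (icut_le_weight_support_sub_component w ha) hb d hd
    omega
  rw [hsplit, map_add, map_add, h1, h2, h3, add_zero, add_zero]

/-- **Lowest weighted form of a power**: under the same hypothesis every monomial of `a ^ n` has
weight `≥ n p` and the weight-`n p` component of `a ^ n` is the `n`-th power of the weight-`p`
component of `a`. [folklore] -/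
theorem icut_component_pow (w : τ → ℕ) {a : MvPolynomial τ K} {p : ℕ}
    (ha : ∀ d ∈ a.support, p ≤ Finsupp.weight w d) (n : ℕ) :
    (∀ d ∈ (a ^ n).support, n * p ≤ Finsupp.weight w d) ∧
      weightedHomogeneousComponent w (n * p) (a ^ n) = weightedHomogeneousComponent w p a ^ n := by
  classical
  induction n with
  | zero =>
    refine ⟨fun d _ => by simp, ?_⟩
    rw [zero_mul, pow_zero, pow_zero]
    exact (isWeightedHomogeneous_one K w).weightedHomogeneousComponent_same
  | succ n ih =>
    obtain ⟨h1, h2⟩ := ih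
    refine ⟨fun d hd => ?_, ?_⟩
    · rw [pow_succ] at hd
      have h := icut_le_weight_support_mul w h1 ha d hd
      rw [Nat.succ_mul]; exact h
    · rw [Nat.succ_mul, pow_succ, pow_succ, icut_component_mul w h1 ha, h2]

variable (T : Set τ) [DecidablePred (· ∈ T)]

/-- Membership in a power of the ideal of the variables `T` forces transverse weight:
every monomial of an element of `(X_v : v ∈ T)^e` has `T`-weight `≥ e`. [folklore] -/
theorem icut_le_weight_of_mem_pow_span (e : ℕ) {f : MvPolynomial τ K}
    (hf : f ∈ Ideal.span (X '' T : Set (MvPolynomial τ K)) ^ e) :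
    ∀ d ∈ f.support, e ≤ Finsupp.weight (fun v => if v ∈ T then 1 else 0) d := by
  classical
  induction e generalizing f with
  | zero => intro d _; exact Nat.zero_le _
  | succ e ih =>
    rw [pow_succ] at hf
    refine Submodule.mul_induction_on hf (fun g hg n hn => ?_) (fun x y hx hy d hd => ?_)
    · have hn1 : ∀ d ∈ n.support, 1 ≤ Finsupp.weight (fun v => if v ∈ T then 1 else 0) d := by
        intro d hd
        obtain ⟨v, hvT, hv⟩ := mem_ideal_span_X_image.mp hn d hd
        have h1 : d v * (if v ∈ T then 1 else 0) ≤
            Finsupp.weight (fun v => if v ∈ T then 1 else 0) d := by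
          rw [Finsupp.weight_apply, Finsupp.sum]
          have hvs : v ∈ d.support := Finsupp.mem_support_iff.mpr hv
          exact Finset.single_le_sum (f := fun i => d i * (if i ∈ T then 1 else 0))
            (fun i _ => Nat.zero_le _) hvs
        rw [if_pos hvT, mul_one] at h1
        have h2 : 1 ≤ d v := Nat.one_le_iff_ne_zero.mpr hv
        exact h2.trans h1
      exact icut_le_weight_support_mul _ (ih hg) hn1
    · have h := Finsupp.support_add hd
      rcases Finset.mem_union.mp h with h | h
      · exact hx d h
      · exact hy d h

/-- A monomial of `T`-weight `≥ e` lies in `(X_v : v ∈ T)^e`. [folklore] -/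
theorem icut_monomial_mem_pow_span {e : ℕ} {d : τ →₀ ℕ}
    (hd : e ≤ Finsupp.weight (fun v => if v ∈ T then 1 else 0) d) (c : K) :
    monomial d c ∈ Ideal.span (X '' T : Set (MvPolynomial τ K)) ^ e := by
  classical
  set J : Ideal (MvPolynomial τ K) := Ideal.span (X '' T) with hJ
  have hw : Finsupp.weight (fun v => if v ∈ T then 1 else 0) d =
      ∑ v ∈ d.support.filter (· ∈ T), d v := by
    rw [Finsupp.weight_apply, Finsupp.sum, Finset.sum_filter]
    refine Finset.sum_congr rfl fun v _ => ?_
    split_ifs <;> simp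
  rw [monomial_eq, Finsupp.prod, ← Finset.prod_filter_mul_prod_filter_not d.support (· ∈ T)]
  refine Ideal.mul_mem_left _ _ (Ideal.mul_mem_right _ _ ?_)
  refine Ideal.pow_le_pow_right (hd.trans_eq hw) ?_
  rw [← Finset.prod_pow_eq_pow_sum]
  refine Ideal.prod_mem_prod fun v hv => Ideal.pow_mem_pow (Ideal.subset_span ?_) _
  exact ⟨v, (Finset.mem_filter.mp hv).2, rfl⟩

/-- Conversely, transverse weight `≥ e` on the whole support gives membership in
`(X_v : v ∈ T)^e`; so the powers of the ideal of a coordinate subspace are the order-of-vanishing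
ideals. [folklore] -/
theorem icut_mem_pow_span_of_le_weight (e : ℕ) {f : MvPolynomial τ K}
    (hf : ∀ d ∈ f.support, e ≤ Finsupp.weight (fun v => if v ∈ T then 1 else 0) d) :
    f ∈ Ideal.span (X '' T : Set (MvPolynomial τ K)) ^ e := by
  rw [f.as_sum]
  exact Ideal.sum_mem _ fun d hd => icut_monomial_mem_pow_span T (hf d hd) _

/-- **Powers of the ideal of a coordinate subspace are integrally closed** (valuative criterion):
over a domain, if `h ^ N + Σ_{i<N} c_i h ^ i = 0` with `c_i ∈ (X_v : v ∈ T)^((N-i) e)`, then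
`h ∈ (X_v : v ∈ T)^e` — compare lowest transverse forms: the one of `h ^ N` is the `N`-th power of
that of `h`, non-zero, of weight `N · ord h`, while every `c_i h^i` only has larger weights once
`ord h < e`. [folklore] -/
theorem icut_mem_pow_span_of_monic [IsDomain K] (h : MvPolynomial τ K) (N e : ℕ)
    (c : ℕ → MvPolynomial τ K)
    (hc : ∀ i < N, c i ∈ Ideal.span (X '' T : Set (MvPolynomial τ K)) ^ ((N - i) * e))
    (heq : h ^ N + ∑ i ∈ Finset.range N, c i * h ^ i = 0) :
    h ∈ Ideal.span (X '' T : Set (MvPolynomial τ K)) ^ e := by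
  classical
  set w : τ → ℕ := fun v => if v ∈ T then 1 else 0 with hwdef
  by_contra hh
  have key : ∃ d ∈ h.support, Finsupp.weight w d < e := by
    by_contra hne
    push Not at hne
    exact hh (icut_mem_pow_span_of_le_weight T e hne)
  obtain ⟨d₀, hd₀, hd₀e⟩ := key
  have hne : (h.support.image (Finsupp.weight w)).Nonempty := ⟨_, Finset.mem_image_of_mem _ hd₀⟩
  set t := (h.support.image (Finsupp.weight w)).min' hne with htdef
  have ht_le : ∀ d ∈ h.support, t ≤ Finsupp.weight w d :=
    fun d hd => Finset.min'_le _ _ (Finset.mem_image_of_mem _ hd)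
  have ht_lt : t < e := (ht_le d₀ hd₀).trans_lt hd₀e
  obtain ⟨d₁, hd₁, hd₁t⟩ : ∃ d₁ ∈ h.support, Finsupp.weight w d₁ = t := by
    have hm := Finset.min'_mem _ hne
    rw [← htdef] at hm
    obtain ⟨d₁, hd₁, h1⟩ := Finset.mem_image.mp hm
    exact ⟨d₁, hd₁, h1⟩
  -- the lowest transverse form of `h`
  have h0 : weightedHomogeneousComponent w t h ≠ 0 := by
    intro h0
    have h1 := congr_arg (coeff d₁) h0
    rw [coeff_weightedHomogeneousComponent, if_pos hd₁t, coeff_zero] at h1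
    exact (mem_support_iff.mp hd₁) h1
  obtain ⟨-, hpow⟩ := icut_component_pow w ht_le N
  have hN : weightedHomogeneousComponent w (N * t) (h ^ N) ≠ 0 := by
    rw [hpow]; exact pow_ne_zero _ h0
  -- every `c_i h^i` has only weights `> N t`
  have hci : ∀ i ∈ Finset.range N, weightedHomogeneousComponent w (N * t) (c i * h ^ i) = 0 := by
    intro i hi
    have hiN := Finset.mem_range.mp hi
    refine weightedHomogeneousComponent_eq_zero' _ _ fun d hd => ?_
    have h1 := icut_le_weight_support_mul w (icut_le_weight_of_mem_pow_span T _ (hc i hiN))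
      (icut_component_pow w ht_le i).1 d hd
    have h2 : N * t < (N - i) * e + i * t := by
      obtain ⟨k, rfl⟩ := Nat.exists_eq_add_of_lt hiN
      have hk : i + k + 1 - i = k + 1 := by omega
      rw [hk]
      nlinarith
    omega
  have hsum : weightedHomogeneousComponent w (N * t) (∑ i ∈ Finset.range N, c i * h ^ i) = 0 := by
    rw [map_sum]
    exact Finset.sum_eq_zero hci
  have hfin : weightedHomogeneousComponent w (N * t) (h ^ N) = 0 := by
    have h1 : h ^ N = -(∑ i ∈ Finset.range N, c i * h ^ i) := eq_neg_of_add_eq_zero_left heq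
    rw [h1, map_neg, hsum, neg_zero]
  exact hN hfin

end Order

/-! ## Registered form (crux stmt-ValiantsHypothesis-12624, sub-goal `powIdealSpanX_integrallyClosed`) -/

/-- **Powers of the ideal of a coordinate subspace are integrally closed** — registered sub-goal
form of `icut_mem_pow_span_of_monic` (pure `Prop`, universe `0`): over a domain `K`, for every set
`T` of variables, `h ^ N + Σ_{i<N} c_i h ^ i = 0` with `c_i ∈ (X_v : v ∈ T)^((N-i) e)` forces
`h ∈ (X_v : v ∈ T)^e`. [folklore] -/
theorem powIdealSpanX_integrallyClosed :
    ∀ {τ K : Type} [CommRing K] [IsDomain K] (T : Set τ) (h : MvPolynomial τ K) (N e : ℕ) (c : ℕ → MvPolynomial τ K), (∀ i < N, c i ∈ Ideal.span (MvPolynomial.X '' T : Set (MvPolynomial τ K)) ^ ((N - i) * e)) → h ^ N + ∑ i ∈ Finset.range N, c i * h ^ i = 0 → h ∈ Ideal.span (MvPolynomial.X '' T : Set (MvPolynomial τ K)) ^ e := by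
  intro τ K _ _ T h N e c hc heq
  classical
  exact icut_mem_pow_span_of_monic T h N e c hc heq

end

end Summit.ValiantsHypothesis.ValiantsHypothesis.Theorems.ValuativeFlip
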